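import Summits.ValiantsHypothesis.ValiantsHypothesis.Theorems.GrenetZeonPolySizeQPAlgebraNilradicalDepth
import HarnessLib

/-!
# The nilradical depth axis of `PolySizeQPAlgebra` (stmt-ValiantsHypothesis-8064): consequences

Companion of `GrenetZeonPolySizeQPAlgebraNilradicalDepth.lean` (semisimplification over an
ARBITRARY finite-dimensional commutative coefficient algebra `R` over an algebraically closed
field: `(nilradical R)^ν = 0` ⟹ every `(m, s)`-representation `f = λ(det A)` is a sum of
`≤ s (m (s - 1) + 1)^(ν - 1)` affine `m × m` determinants, `eq_sum_dets_of_nilradical_pow`).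

## Main results

* `nilradical_pow_finrank_eq_bot` — `(nilradical R)^(dim_k R) = 0` for a finite-dimensional
  commutative `k`-algebra (the powers of the nilradical strictly decrease while nonzero).
* `eq_sum_dets_of_algRepr`, `exists_sum_dets_of_hasAlgDetRepr` — UNCONDITIONALLY, every
  `(m, s)`-representation (`HasAlgDetRepr f m s`, `k` algebraically closed) is a linear combination
  of at most `s (m (s - 1) + 1)^(s - 1)` affine `m × m` determinants over `k`: together with
  `hasAlgDetRepr_sum_dets` the two-parameter model is «short sums of determinants OF THE SAME
  SIZE» up to `s ↦ s (m s)^s`; the dimension parameter buys matrix size only through DEPTH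
  (the exponent is the nilpotency index of the nilradical, not `s`).
* `polySizeBox_nilShallow_of_not_sum_dets`, `polySizeBox_nilShallow_of_polySizeQPAlgebra` — the
  depth axis of stmt-8064 WITHOUT the locality hypothesis of `polySizeBox_shallow_of_not_sum_dets`:
  the ΣDet rung (`not_sum_dets_of_polySizeQPAlgebra`) excludes, inside the box `m ≤ n^c + c`,
  `s ≤ 2^((log₂ n + c)^c)`, every coefficient algebra with `(nilradical R)^((log₂ n + c)^c) = 0`;
  so the content of the `s`-axis of the piece is a nilradical of nilpotency index beyond
  polylog `n` (for `R = ∏` of local algebras: at least one DEEP local factor), not dimension and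
  not the number of local factors.

No stub of the line is closed; `VP ≠ VNP` is not touched.

## References

* P. Hrubeš, A. Yehudayoff, *Arithmetic complexity in ring extensions*, Theory of Computing 7
  (2011), §2. [cite: HrubesYehudayoff2011, §2]
-/

set_option linter.dupNamespace false

noncomputable section

namespace Summit.ValiantsHypothesis.ValiantsHypothesis.Theorems.GrenetZeonPolySizeQPAlgebra

open MvPolynomial Matrix
open Literature.Computability.AlgebraicComplexity
open Summit.ValiantsHypothesis.ValiantsHypothesis.Theses.GrenetZeon

universe u v

section Unconditional

variable {k : Type u} [Field k] {σ : Type v}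

/-- **The nilradical of a finite-dimensional commutative algebra dies in `dim R` steps**:
`(nilradical R)^(finrank_k R) = 0`.  The powers `N^j` strictly decrease while nonzero (if
`N^(j+1) = N^j` then `N^j = N^(j+t) = 0` for a nilpotency exponent `t`,
`IsArtinianRing.isNilpotent_nilradical`), so their dimensions drop by at least one per step.
[folklore] -/
theorem nilradical_pow_finrank_eq_bot {R : Type u} [CommRing R] [Algebra k R] [Module.Finite k R] :
    (nilradical R) ^ (Module.finrank k R) = ⊥ := by
  haveI : IsArtinianRing R := IsArtinianRing.of_finite k R
  obtain ⟨t, ht⟩ := IsArtinianRing.isNilpotent_nilradical (R := R)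
  set N := nilradical R with hN
  have hstep : ∀ j, N ^ (j + 1) = N ^ j → N ^ j = ⊥ := by
    intro j h
    have hall : ∀ i, N ^ (j + i) = N ^ j := by
      intro i
      induction i with
      | zero => rw [add_zero]
      | succ i ih => rw [← add_assoc, pow_succ, ih, ← pow_succ, h]
    rw [← hall t]
    refine le_bot_iff.mp ?_
    calc N ^ (j + t) ≤ N ^ t := Ideal.pow_le_pow_right (Nat.le_add_left t j)
      _ = ⊥ := by rw [ht, Ideal.zero_eq_bot]
  have hdim : ∀ j, N ^ j = ⊥ ∨
      Module.finrank k ((N ^ j).restrictScalars k) + j ≤ Module.finrank k R := by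
    intro j
    induction j with
    | zero =>
      right
      rw [pow_zero, Ideal.one_eq_top, Submodule.restrictScalars_top, finrank_top, add_zero]
    | succ j ih =>
      rcases ih with h | h
      · left
        rw [pow_succ, h, Ideal.bot_mul]
      · by_cases h' : N ^ (j + 1) = ⊥
        · exact Or.inl h'
        right
        have hne : N ^ j ≠ ⊥ := fun h0 => h' (by rw [pow_succ, h0, Ideal.bot_mul])
        have hne' : N ^ (j + 1) ≠ N ^ j := fun heq => hne (hstep j heq)
        have hle : N ^ (j + 1) ≤ N ^ j := Ideal.pow_le_pow_right (Nat.le_succ j)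
        have hlt : (N ^ (j + 1)).restrictScalars k < (N ^ j).restrictScalars k :=
          lt_of_le_of_ne (fun x hx => hle hx)
            (fun heq => hne' (Submodule.restrictScalars_injective k R R heq))
        have := Submodule.finrank_lt_finrank_of_lt hlt
        omega
  rcases hdim (Module.finrank k R) with h | h
  · exact h
  · have h0 : Module.finrank k ((N ^ Module.finrank k R).restrictScalars k) = 0 := by omega
    rw [Submodule.finrank_eq_zero, Submodule.restrictScalars_eq_bot_iff] at h0
    exact h0

/-- **Every `(m, s)`-representation is a short sum of determinants OF THE SAME SIZE.** Over an
algebraically closed field, if `f = λ(det A)` coefficientwise for an `m × m` matrix of affine forms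
over a commutative coefficient algebra `R` with `dim R ≤ s`, then `f` is a linear combination of at
most `s · (m (s - 1) + 1)^(s - 1)` affine `m × m` determinants over `k`
(`eq_sum_dets_of_nilradical_pow` with `ν = dim R`, `nilradical_pow_finrank_eq_bot`).  With
`hasAlgDetRepr_sum_dets` (a sum of `G` determinants is an `(m, G)`-representation) the
two-parameter model is, up to `s ↦ s (m s)^s`, the model «sums of `m × m` affine determinants»:
the dimension parameter buys matrix size only through DEPTH (exponent `ν - 1`).
[cite: HrubesYehudayoff2011, §2] -/
theorem eq_sum_dets_of_algRepr [IsAlgClosed k] {f : MvPolynomial σ k} {m s : ℕ}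
    {R : Type u} [CommRing R] [Algebra k R] [Module.Finite k R]
    (hs : Module.finrank k R ≤ s) (l : R →ₗ[k] k)
    (A : Matrix (Fin m) (Fin m) (MvPolynomial σ R)) (hA : ∀ i j, (A i j).totalDegree ≤ 1)
    (hf : ∀ d : σ →₀ ℕ, l (coeff d A.det) = coeff d f) :
    ∃ (G : ℕ) (α : Fin G → k) (B : Fin G → Matrix (Fin m) (Fin m) (MvPolynomial σ k)),
      G ≤ s * (m * (s - 1) + 1) ^ (s - 1) ∧ (∀ q i j, (B q i j).totalDegree ≤ 1) ∧
        f = ∑ q, C (α q) * (B q).det := by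
  obtain ⟨G, α, B, hG, hB, hfB⟩ :=
    eq_sum_dets_of_nilradical_pow (nilradical_pow_finrank_eq_bot (k := k)) hs l A hA hf
  exact ⟨G, α, B, hG.trans (Nat.mul_le_mul_left s
    (Nat.pow_le_pow_right (Nat.succ_pos _) (Nat.sub_le_sub_right hs 1))), hB, hfB⟩

/-- **`HasAlgDetRepr f m s` ⟹ `f` is a sum of at most `s (m (s - 1) + 1)^(s - 1)` affine `m × m`
determinants** (over an algebraically closed field; the `∃`-packaged form of
`eq_sum_dets_of_algRepr`). [cite: HrubesYehudayoff2011, §2] -/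
theorem exists_sum_dets_of_hasAlgDetRepr [IsAlgClosed k] {f : MvPolynomial σ k} {m s : ℕ}
    (h : HasAlgDetRepr f m s) :
    ∃ (G : ℕ) (α : Fin G → k) (B : Fin G → Matrix (Fin m) (Fin m) (MvPolynomial σ k)),
      G ≤ s * (m * (s - 1) + 1) ^ (s - 1) ∧ (∀ q i j, (B q i j).totalDegree ≤ 1) ∧
        f = ∑ q, C (α q) * (B q).det := by
  obtain ⟨R, _, _, _, hR, l, A, hA, hf⟩ := h
  exact eq_sum_dets_of_algRepr hR l A hA hf


end Unconditional

/-! ### The depth axis of stmt-8064 without locality -/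

section DepthAxis

/-- Count bookkeeping: `s · (m (s - 1) + 1)^(ν - 1) ≤ ((m + 1) s)^ν` for `1 ≤ ν`. [folklore] -/
theorem mul_pow_pred_le_pow {m s ν : ℕ} (hν : 1 ≤ ν) :
    s * (m * (s - 1) + 1) ^ (ν - 1) ≤ ((m + 1) * s) ^ ν := by
  rcases Nat.eq_zero_or_pos s with rfl | hs
  · simp
  have h1 : m * (s - 1) + 1 ≤ (m + 1) * s := by
    have : m * (s - 1) + m = m * s := by
      rw [← Nat.mul_succ, Nat.succ_eq_add_one, Nat.sub_add_cancel hs]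
    nlinarith
  have h2 : s ≤ (m + 1) * s := by nlinarith
  calc s * (m * (s - 1) + 1) ^ (ν - 1) ≤ ((m + 1) * s) * ((m + 1) * s) ^ (ν - 1) :=
        Nat.mul_le_mul h2 (Nat.pow_le_pow_left h1 _)
    _ = ((m + 1) * s) ^ ν := by
        rw [← pow_succ']
        congr 1
        omega

/-- **The ΣDet rung excludes every coefficient algebra of polylogarithmic nilpotency index
(depth axis of stmt-8064, non-local form).** If, for every `c`, for all large `n`, `per_n` is not a
linear combination of `≤ 2^((log₂ n + c)^c)` affine determinants of size `≤ n^c + c`, then for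
every `c`, for all large `n`, `per_n` has NO `(m, s)`-representation with `m ≤ n^c + c`,
`s ≤ 2^((log₂ n + c)^c)` over ANY commutative coefficient algebra `R` with
`(nilradical R)^((log₂ n + c)^c) = 0`.  (`eq_sum_dets_of_nilradical_pow`: such a representation is
a sum of `≤ s (m (s - 1) + 1)^(depth - 1) ≤ ((m + 1) s)^depth ≤ 2^((log₂ n + 2c + 4)^(2c + 4))`
determinants of the same size, `depth_budget`.)  So inside the box of the piece, commuting
coefficients matter only through a nilradical of nilpotency index beyond polylog `n` — for a
product of local algebras, through at least one DEEP local factor. [cite: HrubesYehudayoff2011, §2] -/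
theorem polySizeBox_nilShallow_of_not_sum_dets
    (hSum : ∀ c : ℕ, ∃ n₀ : ℕ, ∀ n ≥ n₀, ∀ m s : ℕ, m ≤ n ^ c + c → s ≤ 2 ^ ((Nat.log 2 n + c) ^ c) →
      ∀ (A : Fin s → Matrix (Fin m) (Fin m) (MvPolynomial (Fin n × Fin n) ℂ)) (α : Fin s → ℂ),
        (∀ i j k, (A i j k).totalDegree ≤ 1) → perPoly (Fin n) ℂ ≠ ∑ i, C (α i) * (A i).det)
    (c : ℕ) :
    ∃ n₀ : ℕ, ∀ n ≥ n₀, ∀ m s : ℕ, m ≤ n ^ c + c → s ≤ 2 ^ ((Nat.log 2 n + c) ^ c) →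
      ∀ (R : Type) [CommRing R] [Algebra ℂ R] [Module.Finite ℂ R],
        (nilradical R) ^ ((Nat.log 2 n + c) ^ c) = ⊥ → Module.finrank ℂ R ≤ s →
          ∀ (l : R →ₗ[ℂ] ℂ) (A : Matrix (Fin m) (Fin m) (MvPolynomial (Fin n × Fin n) R)),
            (∀ i j, (A i j).totalDegree ≤ 1) →
              ¬ ∀ d : (Fin n × Fin n) →₀ ℕ, l (coeff d A.det) = coeff d (perPoly (Fin n) ℂ) := by
  obtain ⟨n₀, h⟩ := hSum (2 * c + 4)
  refine ⟨max n₀ 1, fun n hn m s hm hs R _ _ _ hν hR l A hA hf => ?_⟩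
  have hn₀ : n₀ ≤ n := le_of_max_le_left hn
  have hn1 : 1 ≤ n := le_of_max_le_right hn
  obtain ⟨G, α, B, hG, hB, hper⟩ := eq_sum_dets_of_nilradical_pow hν hR l A hA hf
  have hν1 : 1 ≤ (Nat.log 2 n + c) ^ c := by
    rcases Nat.eq_zero_or_pos c with hc | hc
    · rw [hc, pow_zero]
    · exact Nat.one_le_pow _ _ (by omega)
  have hG' : G ≤ 2 ^ ((Nat.log 2 n + (2 * c + 4)) ^ (2 * c + 4)) :=
    hG.trans ((mul_pow_pred_le_pow hν1).trans (depth_budget hm hs le_rfl))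
  have hm' : m ≤ n ^ (2 * c + 4) + (2 * c + 4) :=
    hm.trans (Nat.add_le_add (Nat.pow_le_pow_right hn1 (by omega)) (by omega))
  exact h n hn₀ m G hm' hG' B α hB hper

/-- **Corollary: `PolySizeQPAlgebra` decides its own shallow part — non-local form.**
`PolySizeQPAlgebra` ⟹ (no qp-long sum of poly-size determinants,
`not_sum_dets_of_polySizeQPAlgebra`) ⟹ (no representation in the box over any coefficient algebra
whose nilradical has polylogarithmic nilpotency index).  With `polySizeBox_shallow_of_not_sum_dets`
(local form) this completes the census statement of stmt-8064's depth axis: the content of the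
`s`-axis is a DEEP nilradical, not dimension and not the number of local factors.
[cite: HrubesYehudayoff2011, §2] -/
theorem polySizeBox_nilShallow_of_polySizeQPAlgebra (hP : PolySizeQPAlgebra) (c : ℕ) :
    ∃ n₀ : ℕ, ∀ n ≥ n₀, ∀ m s : ℕ, m ≤ n ^ c + c → s ≤ 2 ^ ((Nat.log 2 n + c) ^ c) →
      ∀ (R : Type) [CommRing R] [Algebra ℂ R] [Module.Finite ℂ R],
        (nilradical R) ^ ((Nat.log 2 n + c) ^ c) = ⊥ → Module.finrank ℂ R ≤ s →
          ∀ (l : R →ₗ[ℂ] ℂ) (A : Matrix (Fin m) (Fin m) (MvPolynomial (Fin n × Fin n) R)),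
            (∀ i j, (A i j).totalDegree ≤ 1) →
              ¬ ∀ d : (Fin n × Fin n) →₀ ℕ, l (coeff d A.det) = coeff d (perPoly (Fin n) ℂ) :=
  polySizeBox_nilShallow_of_not_sum_dets (not_sum_dets_of_polySizeQPAlgebra hP) c

end DepthAxis

end Summit.ValiantsHypothesis.ValiantsHypothesis.Theorems.GrenetZeonPolySizeQPAlgebra

end
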